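import Summits.HodgeConjecture.HodgeConjecture.Theses.NikulinTwinTransport

/-!
# `TwinTwistorTransport` (stmt-HodgeConjecture-14393, typed rev-7 form) · Negative · no odd self-anchor

Negative knowledge for the typed OUTPUT form of the crux `TwinTwistorTransport` (route
NikulinTwinTransport, r4): "every projective K3 surface `S` has a projective K3 partner `S″` and an
algebraic `ℂ`-linear equivalence `Ψ : H²(S″) ≃ H²(S)` whose inverse is a rational, type-preserving
`½`-similitude".  The natural strengthening "`S″` may be taken equal to `S`" is FALSE whenever
`rk T(S) = 22 − ρ(S)` is odd (e.g. `ρ(S) = 1`, the very general projective K3): a rational Hodge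
similitude maps the transcendental lattice `T(S)_ℚ` onto `T(S″)_ℚ`, and a nondegenerate quadratic
`ℚ`-space of ODD dimension has no self-similitude of multiplier `2`, because
`det(M)² · det G = 2ⁿ · det G` forces `det(M)² = 2ⁿ`, and `2` is not a rational square
(`no_self_twoSimilitude_of_odd`).  More generally `det_sq_mul_det_of_twoSimilitude` shifts the
discriminant class by `2ⁿ`: for odd rank the twin `S″` is never even rationally Hodge-ISOMETRIC to
`S` (`no_isometric_twin_of_odd`: no Fourier–Mukai partner, no Buskin isometry), so the `∃ S″` of the crux is load-bearing and
the anchor class it asks for is genuinely a similitude class, outside the reach of Buskin 2019 alone.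
In even rank self-similitudes of multiplier `2` do exist (`self_twoSimilitude_even_example`: `U(2) ⊂ U`,
the block of the landed `eEightTwoSimilitude_proof`), so oddness is the point.  Model: Gram matrices
over `ℚ` on `Fin n`.
Refuter seat refuter-cdisprove-stmt-HodgeConjecture-14393-0 (gen 1, typed form), 2026-08-16; work file
`Cruxes/TwinTwistorTransport/Disproof.lean` §T3.
-/

namespace Summit.HodgeConjecture.HodgeConjecture.Theorems.TwinTwistorTransport.Negative

open scoped Matrix

/-- DISCRIMINANT SHIFT.  If `M` is a 2-similitude from the form `G″` to the form `G` on `ℚⁿ`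
(`Mᵀ G M = 2 G″`), then `det(M)² · det G = 2ⁿ · det G″`. [folklore] -/
theorem det_sq_mul_det_of_twoSimilitude {n : ℕ} (G G'' M : Matrix (Fin n) (Fin n) ℚ)
    (h : Mᵀ * G * M = (2 : ℚ) • G'') : M.det ^ 2 * G.det = 2 ^ n * G''.det := by
  have hd := congrArg Matrix.det h
  rw [Matrix.det_mul, Matrix.det_mul, Matrix.det_transpose, Matrix.det_smul, Fintype.card_fin] at hd
  rw [← hd]
  ring

/-- An isometry `N` from `G″` to `G` (`Nᵀ G N = G″`) gives `det(N)² · det G = det G″`. [folklore] -/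
theorem det_sq_mul_det_of_isometry {n : ℕ} (G G'' N : Matrix (Fin n) (Fin n) ℚ)
    (h : Nᵀ * G * N = G'') : N.det ^ 2 * G.det = G''.det := by
  have hd := congrArg Matrix.det h
  rw [Matrix.det_mul, Matrix.det_mul, Matrix.det_transpose] at hd
  rw [← hd]
  ring

/-- `2` is not the square of a rational number. [folklore] -/
theorem not_exists_rat_mul_self_eq_two : ¬ ∃ q : ℚ, q * q = 2 := by
  rintro ⟨q, hq⟩
  have h : Real.sqrt 2 = |(q : ℝ)| := by
    rw [← Real.sqrt_mul_self_eq_abs, ← Rat.cast_mul, hq]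
    norm_num
  exact irrational_sqrt_two.ne_rat |q| (by rw [h, Rat.cast_abs])

/-- `q² ≠ 2^(2k+1) · r²` for rationals `q` and `r ≠ 0` (an odd power of `2` is not a rational square).
[folklore] -/
theorem rat_sq_ne_odd_pow_two_mul_sq (q r : ℚ) (hr : r ≠ 0) (k : ℕ) :
    q ^ 2 ≠ 2 ^ (2 * k + 1) * r ^ 2 := by
  intro h
  apply not_exists_rat_mul_self_eq_two
  refine ⟨q / (2 ^ k * r), ?_⟩
  have h2k : (2 : ℚ) ^ k * r ≠ 0 := mul_ne_zero (pow_ne_zero _ two_ne_zero) hr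
  rw [div_mul_div_comm, ← sq, ← sq, h, div_eq_iff (pow_ne_zero 2 h2k)]
  ring

/-- NO ODD SELF-ANCHOR.  A nondegenerate quadratic `ℚ`-space of odd dimension admits no
self-similitude of multiplier `2` (`det M² = 2ⁿ` is impossible for odd `n`).  Consequence for the
crux: a rational Hodge similitude maps `T(S)` to `T(S″)`; if `S″ = S` and `rk T(S) = 22 − ρ(S)` is
odd (e.g. `ρ(S) = 1`, the very general projective K3), restricting `Ψ` to `T(S)_ℚ` contradicts this
lemma.  So the natural strengthening "`S″` may be taken equal to `S`" is FALSE and the existential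
`∃ S″` of the crux is load-bearing (prior seat rattack-14393: "S″ = S impossible for odd ρ").
[folklore] -/
theorem no_self_twoSimilitude_of_odd {n : ℕ} (hn : Odd n) (G M : Matrix (Fin n) (Fin n) ℚ)
    (hG : G.det ≠ 0) (h : Mᵀ * G * M = (2 : ℚ) • G) : False := by
  have h1 := det_sq_mul_det_of_twoSimilitude G G M h
  have h2 : M.det ^ 2 = 2 ^ n := mul_right_cancel₀ hG h1
  obtain ⟨k, rfl⟩ := hn
  exact rat_sq_ne_odd_pow_two_mul_sq M.det 1 one_ne_zero k (by rw [h2]; ring)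

/-- NO ISOMETRIC TWIN IN ODD RANK.  If nondegenerate forms `G`, `G″` of odd dimension are related
both by a 2-similitude `M` (`Mᵀ G M = 2G″`) and by an isometry `N` (`Nᵀ G N = G″`), contradiction:
`det(M)² = 2ⁿ det(N)²`.  Consequence for the crux: when `rk T(S)` is odd the twin `S″` is NEVER
rationally Hodge-isometric to `S` on `T` — not a Fourier–Mukai partner, not reachable by
Buskin's theorem (`HodgeIsometryAlgebraic`) alone; the anchor class the crux asks for is a
genuinely new (similitude) algebraic class. [folklore] -/
theorem no_isometric_twin_of_odd {n : ℕ} (hn : Odd n) (G G'' M N : Matrix (Fin n) (Fin n) ℚ)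
    (hG : G.det ≠ 0) (hG'' : G''.det ≠ 0) (hM : Mᵀ * G * M = (2 : ℚ) • G'')
    (hN : Nᵀ * G * N = G'') : False := by
  have h1 := det_sq_mul_det_of_twoSimilitude G G'' M hM
  have h2 := det_sq_mul_det_of_isometry G G'' N hN
  have hNd : N.det ≠ 0 := by
    intro h0
    apply hG''
    rw [← h2, h0]
    ring
  have h3 : M.det ^ 2 = 2 ^ n * N.det ^ 2 := by
    apply mul_right_cancel₀ hG
    rw [h1, ← h2]
    ring
  obtain ⟨k, rfl⟩ := hn
  exact rat_sq_ne_odd_pow_two_mul_sq M.det N.det hNd k h3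

/-- Non-vacuity in EVEN dimension (so oddness is the point): on `ℚ²` with the hyperbolic form `U`,
`M = diag(1, 2)` is a self-similitude of multiplier `2` (`U(2) ⊂ U`, the block used by TwinExists /
`eEightTwoSimilitude_proof`). [folklore] -/
theorem self_twoSimilitude_even_example :
    (!![1, 0; 0, 2] : Matrix (Fin 2) (Fin 2) ℚ)ᵀ * !![0, 1; 1, 0] * !![1, 0; 0, 2] =
      (2 : ℚ) • !![0, 1; 1, 0] ∧ (!![0, 1; 1, 0] : Matrix (Fin 2) (Fin 2) ℚ).det ≠ 0 := by
  constructor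
  · ext i j
    fin_cases i <;> fin_cases j <;>
      simp [Matrix.mul_apply, Fin.sum_univ_two, Matrix.transpose_apply, Matrix.smul_apply]
  · simp [Matrix.det_fin_two]

end Summit.HodgeConjecture.HodgeConjecture.Theorems.TwinTwistorTransport.Negative
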